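import Summits.Ventures.HSemireg.Pad4TowerUniverseDT1

/-!
# Venture HSemireg — PAD-4: THEOREM X∞, first half in the kernel — LEMMA X∞-A (the charge induction) and COROLLARY A′
# (no class with an O-letter is charged on two factors), (F1ℝ) slice, alphabet 𝒰 UNBOUNDED, no `decide` over a universe

HONEST FRAMING. Lean index of the computation cell `pub-hsemireg` (S4-PUSH, H2 door PAD-4); seat `hodge-semireg-assembly-p1`
(director-hodge g8 l.30592: «memo §6 typed sentence … = your post-#5 kernel target, proof by the induction not decide»). Source:
bc5-plan g4, `hodge-bloch-bc5-plan/BC5-PLAN-g4-MEMO.md` v4.1 df3e4f41db3c2fcf — **THEOREM X∞ (pencil ×1; LEG A ∕ LEG B referee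
reads ROUTED at typing time, not yet on the bus)**: «let 𝒰 = {O} ∪ {c·ℓ_u} ∪ {2I + c·ℓ_u} (c ≥ 1 UNBOUNDED). Every finite two-level
support S ⊂ 𝒰⁴ × {N,P} that is RULE-D-closed, phase-sibling-closed (PSC) and X-clean is JUNK (every class charged on ≤ 1 factor) ⇒
μ = 0 ⇒ ¬(H1). No Ψ-row, no FC1, no per-U core, no height bound.» Its proof has two halves: §2 LEMMA X∞-A (charge induction) + §3
COROLLARY A′ ⇒ no class charged on ≥ 2 factors carries an O-letter; §4 LEMMA X∞-B (extremal descent) ⇒ the fully charged world is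
empty. THIS FILE PROVES THE FIRST HALF in the kernel, on the (F1ℝ) slice and in the memo's own typed vocabulary (§6): `InUscr`, `PSC`,
`XClean` verbatim (with `setRay`∕`swapAt` for the memo's `setAt`∕`swapAt`). LEMMA X∞-B is NOT here (it is the half LEG B attacks:
(B4)∕(B5)); hence THEOREM X∞'s conclusion «junk ⇒ μ = 0» is NOT claimed by this file.

WHAT IS PROVED (no universe list, no certificate, no `decide` beyond `Fin 4` bookkeeping; RULE D = `Pad4TowerLemmaT`'s, used through
`servedBelow_of_zero` and `RuleDP`):
* `xinfA_N` ∕ `xinfA_P` ∕ `xinfA` ∕ `no_mixed` — **LEMMA X∞-A**: in a RULE-D-closed, PSC, X-clean configuration whose `P`-cells lie in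
  `𝒰`, NO cell of either level is `Mixed` (an O-factor, a pure-ray factor, and a further charged factor). Strong induction on the ray
  charge `c` in the memo's order (N_c) [uses (P_{c′}), c′ < c: RULE D at (ray c, O-coordinate 0) forces a `(σ,s)`-leg; a leg or an
  intermediate own ray of positive charge would be a `Mixed` P of smaller charge; so the leg is the full cancellation, PSC supplies the
  sibling, and `XClean` is contradicted] then (P_c) [uses (N_c): every server∕cover above the further factors is a `Mixed` N of charge
  c; CASE A (two further charged factors): RULE D between them forces their four coordinates equal — impossible for a charged letter of
  `𝒰` (`coords_ne_of_charged`); CASE B (a second O-factor): the pair (O-coordinate, charged coordinate) has neither server nor cover].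
* `no_O_biCharged_N` ∕ `no_O_biCharged_P` — **COROLLARY A′** (memo §3, first sentence): with all cells in `𝒰`, no cell with an
  O-factor is charged on two further factors [N: a charged non-ray letter is a tower (c+1,1); RULE D against the O-factor serves its
  coordinate 1 below by the antipodal partner carrying the pure ray (c+1)ℓ — a `Mixed` P; P: RULE D at (own coordinate ≥ 2 of one
  tower, antipodal 1 of the other): the own-up server is an N with an O-letter charged twice, the antipodal raise leaves `𝒰`].
Hypotheses are EXACTLY the memo's (S-i) `RuleDClosed`, (S-ii) `XClean`, (S-iii) `PSC`, plus `InUscr` where used (P-cells in X∞-A;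
both levels in A′). The (E1)-meaning of `XClean`'s forbidden configuration (LEMMA X-PHASE at general depth, §22 REMARK (2)) and of RULE
D are pencil, as everywhere in this directory.

WHAT IS NOT HERE ∕ NOT IN LEAN. LEMMA X∞-B and THEOREM X∞'s conclusion; the second sentence of A′ (partners of FC classes are FC —
immediate from the first, left to the X∞-B file); μ₄ phases `±i`; modes∕sections. Nothing is a statement about a variety, a sheaf, σ, a
seed or an abelian variety; NOTHING HERE SAYS THAT HC ∕ HC_CM ∕ HC_AV ∕ W₆ ∕ HC_Kum4Type HOLDS OR FAILS. No `instance`, no notation, no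
named fact, 0 `sorry`; axioms standard.

SOURCES (sha16): BC5-PLAN-g4-MEMO.md v4.1 df3e4f41db3c2fcf §0–§3, §6 (typed sentence), §10 (LEG A∕B asks); director-hodge g8 cell
INBOX l.30592; s4-ref g73 5f7ec243906f3e2e ∕ 338a11775cdb217f (X-collapse legs, mode-I strike — the partner structure of (N_c));
`Pad4TowerLemmaT.lean` bfb2cc0a1a90b649 (RULE D, `servedBelow_of_zero`); `Pad4TowerUniverseDT1` (keys, this seat).
-/

namespace Summit.Ventures.HSemireg.Pad4Tower

open Finset

/-! ## §1 The scope predicates of THEOREM X∞ (bc5-plan g4 memo v4.1 §6, (F1ℝ) vocabulary) -/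

/-- the alphabet `𝒰` in light-cone form: `O`, pure rays `(c,0)`∕`(0,c)`, simple towers `(c+1,1)`∕`(1,c+1)` (`c ≥ 1`) — relative levels
`{0,2}`, no bare node, charges UNBOUNDED (memo §6 `InUscr`). -/
abbrev InUscr (X : Cell) : Prop := ∀ f, X f 0 = 0 ∨ X f 1 = 0 ∨ (min (X f 0) (X f 1) = 1 ∧ 2 ≤ max (X f 0) (X f 1))

/-- the cell with the two sides of factor `σ` swapped (the phase sibling on `σ`). -/
def swapAt (Z : Cell) (σ : Fin 4) : Cell := fun g r => if g = σ then Z g r.rev else Z g r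

/-- the cell with factor `σ` replaced by the pure ray of charge `c` on side `s` (`c = 0`: by `O`). -/
def setRay (Z : Cell) (σ : Fin 4) (s : Fin 2) (c : ℕ) : Cell := fun g r => if g = σ then (if r = s then c else 0) else Z g r

/-- **PSC** — phase-sibling closure at `N`-cells with an O-factor (memo §6 (S-iii); G-invariance suffices). -/
abbrev PSC (C : Config) : Prop := ∀ Z ∈ C.lower, (∃ f, isO Z f) → ∀ σ, swapAt Z σ ∈ C.lower

/-- **XClean** — no `N`-cell meets the apex-vertex instance of LEMMA X-PHASE at general depth (memo §6 (S-ii)): an O-factor `f`, a pure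
ray of charge `c` on `(σ,s)`, the full cancellation `Z[σ ↦ O]` present as a `P`, NO intermediate own-ray `P` `Z[σ ↦ c′ℓ_{±}]`
(`1 ≤ c′ < c`), and the sibling `Z[σ: sides swapped]` present as an `N`. Pencil meaning (NOT in Lean): such a `Z` violates (E1). -/
abbrev XClean (C : Config) : Prop :=
  ∀ Z ∈ C.lower, ∀ f σ : Fin 4, f ≠ σ → isO Z f → ∀ s : Fin 2, Z σ s ≠ 0 → Z σ s.rev = 0 →
    ¬ (setRay Z σ s 0 ∈ C.upper ∧ (∀ c', c' < Z σ s → 1 ≤ c' → setRay Z σ s c' ∉ C.upper ∧ setRay Z σ s.rev c' ∉ C.upper) ∧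
        swapAt Z σ ∈ C.lower)

/-- the configurations attacked by LEMMA X∞-A: an O-factor `f`, a pure ray on `(σ,s)`, and a further charged factor. -/
abbrev Mixed (Z : Cell) (f σ : Fin 4) (s : Fin 2) : Prop := isO Z f ∧ pureRay Z σ s ∧ ∃ g, g ≠ f ∧ g ≠ σ ∧ ¬ isO Z g

/-! ## §2 Bookkeeping -/

/-- `setRay` on the overwritten side `σ`: the pure ray `(σ,s) ↦ c`. -/
theorem setRay_self (Z : Cell) (σ : Fin 4) (s r : Fin 2) (c : ℕ) : setRay Z σ s c σ r = if r = s then c else 0 := by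
  simp [setRay]

/-- `setRay` leaves every other side `g ≠ σ` untouched. -/
theorem setRay_ne (Z : Cell) {σ g : Fin 4} (hg : g ≠ σ) (s r : Fin 2) (c : ℕ) : setRay Z σ s c g r = Z g r := by
  simp [setRay, hg]

/-- a `(σ,s)`-leg of a cell whose `σ`-letter is a pure ray on side `s` is the ray cell of its own `σ`-value. -/
theorem eq_setRay_of_agree {P Z : Cell} {σ : Fin 4} {s : Fin 2} (hag : Agree1 P Z σ s) (h0 : Z σ s.rev = 0) :
    P = setRay Z σ s (P σ s) := by
  funext g r
  by_cases hg : g = σ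
  · subst hg
    rw [setRay_self]
    by_cases hr : r = s
    · subst hr; simp
    · rw [if_neg hr, hag g r (fun h => hr h.2), Fin2.eq_rev_of_ne r s hr, h0]
  · rw [setRay_ne Z hg, hag g r (fun h => hg h.1)]

/-- `Mixed` is inherited by a cell that agrees with `Z` on `f`, `σ` and on a charged third factor. -/
theorem mixed_of_eq {N Z : Cell} {f σ g : Fin 4} {s : Fin 2} (hO : isO Z f) (hray : pureRay Z σ s) (hgf : g ≠ f)
    (hgσ : g ≠ σ) (hf : ∀ r, N f r = Z f r) (hσ : ∀ r, N σ r = Z σ r) (hch : ¬ isO N g) : Mixed N f σ s :=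
  ⟨⟨by rw [hf]; exact hO.1, by rw [hf]; exact hO.2⟩, ⟨by rw [hσ]; exact hray.1, by rw [hσ]; exact hray.2⟩, g, hgf, hgσ, hch⟩

/-- the own-ray cells `Z[σ ↦ c′ℓ]` (`c′ ≥ 1`, either side) of a `Mixed` cell are `Mixed` of charge `c′`. -/
theorem mixed_setRay {Z : Cell} {f σ : Fin 4} {s : Fin 2} (hm : Mixed Z f σ s) (hfσ : f ≠ σ) (t : Fin 2) {c' : ℕ}
    (hc' : 1 ≤ c') : Mixed (setRay Z σ t c') f σ t := by
  obtain ⟨hO, -, g, hgf, hgσ, hch⟩ := hm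
  refine ⟨⟨by rw [setRay_ne Z hfσ]; exact hO.1, by rw [setRay_ne Z hfσ]; exact hO.2⟩, ⟨?_, ?_⟩, g, hgf, hgσ, ?_⟩
  · rw [setRay_self, if_pos rfl]; omega
  · rw [setRay_self, if_neg (by fin_cases t <;> decide)]
  · intro hO'; apply hch; exact ⟨by rw [← setRay_ne Z hgσ t 0 c']; exact hO'.1, by rw [← setRay_ne Z hgσ t 1 c']; exact hO'.2⟩

/-- the fourth factor. -/
theorem exists_fourth (f σ g : Fin 4) : ∃ h : Fin 4, h ≠ f ∧ h ≠ σ ∧ h ≠ g := by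
  revert f σ g; decide

/-- in `𝒰` a charged letter has two DIFFERENT light-cone coordinates (rays `(c,0)`, towers `(c+1,1)`; no bare node). -/
theorem coords_ne_of_charged {X : Cell} (hU : InUscr X) {g : Fin 4} (hch : ¬ isO X g) : X g 0 ≠ X g 1 := by
  intro heq
  rcases hU g with h | h | ⟨hmin, hmax⟩
  · exact hch ⟨h, heq ▸ h⟩
  · exact hch ⟨heq ▸ h, h⟩
  · rw [heq, min_self] at hmin; rw [heq, max_self] at hmax; omega

/-- a `(σ,s)`-leg of positive charge of a `Mixed` cell is `Mixed` (same O-factor, same charged factor). -/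
theorem mixed_of_leg {P Z : Cell} {f σ : Fin 4} {s : Fin 2} (hag : Agree1 P Z σ s) (hne : P σ s ≠ 0) (hm : Mixed Z f σ s)
    (hfσ : f ≠ σ) : Mixed P f σ s := by
  obtain ⟨hO, hray, g, hgf, hgσ, hch⟩ := hm
  refine ⟨⟨?_, ?_⟩, ⟨hne, ?_⟩, g, hgf, hgσ, fun hO' => hch ⟨?_, ?_⟩⟩
  · rw [hag f 0 (fun h => hfσ h.1)]; exact hO.1
  · rw [hag f 1 (fun h => hfσ h.1)]; exact hO.2
  · rw [hag σ s.rev (fun h => absurd h.2 (by fin_cases s <;> decide))]; exact hray.2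
  · rw [← hag g 0 (fun h => hgσ h.1)]; exact hO'.1
  · rw [← hag g 1 (fun h => hgσ h.1)]; exact hO'.2

/-! ## §3 LEMMA X∞-A: no `Mixed` cell on either level (induction on the ray charge; memo v4.1 §2) -/

section
variable {C : Config} (hD : RuleDClosed C) (hS : PSC C) (hX : XClean C) (hU : ∀ P ∈ C.upper, InUscr P)

include hD hS hX in
/-- **(N_c)**: if no `P`-cell is `Mixed` with a ray charge `< c`, then no `N`-cell is `Mixed` with ray charge `c`. RULE D at the pair
((σ,s) = c, (f,s) = 0) forces a `(σ,s)`-leg (`Pad4TowerLemmaT.servedBelow_of_zero`); a leg of positive charge would be a `Mixed`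
`P` of smaller charge, so the leg is the full cancellation; the intermediate own rays are absent for the same reason; PSC gives the
sibling; XClean forbids exactly this. -/
theorem xinfA_N {c : ℕ} (ih : ∀ c' < c, ∀ P ∈ C.upper, ∀ f σ s, P σ s = c' → ¬ Mixed P f σ s)
    {Z : Cell} (hZ : Z ∈ C.lower) {f σ : Fin 4} {s : Fin 2} (hc : Z σ s = c) (hm : Mixed Z f σ s) : False := by
  have hm' := hm
  obtain ⟨hO, hray, g, hgf, hgσ, hch⟩ := hm
  have hfσ : f ≠ σ := fun h => hray.1 (by rw [← h]; fin_cases s; exacts [hO.1, hO.2])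
  have hf0 : Z f s = 0 := by fin_cases s; exacts [hO.1, hO.2]
  obtain ⟨P, hPu, hag, hlt⟩ := servedBelow_of_zero C (hD.1 Z hZ) hf0 (Ne.symm hfσ) hray.1
  have hP0 : P σ s = 0 := by
    by_contra hne
    exact ih (P σ s) (by omega) P hPu f σ s rfl (mixed_of_leg hag hne hm' hfσ)
  have hq : setRay Z σ s 0 ∈ C.upper := by
    have := eq_setRay_of_agree hag hray.2
    rw [hP0] at this
    exact this ▸ hPu
  refine hX Z hZ f σ hfσ hO s hray.1 hray.2 ⟨hq, fun c' hc' h1 => ⟨fun hmem => ?_, fun hmem => ?_⟩, hS Z hZ ⟨f, hO⟩ σ⟩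
  · exact ih c' (by omega) _ hmem f σ s (by rw [setRay_self, if_pos rfl]) (mixed_setRay hm' hfσ s h1)
  · exact ih c' (by omega) _ hmem f σ s.rev (by rw [setRay_self, if_pos rfl]) (mixed_setRay hm' hfσ s.rev h1)

include hD hU in
/-- **(P_c)**: if no `N`-cell is `Mixed` with ray charge `c`, then no `P`-cell is. Every server ∕ cover from above of the further
factors keeps the O-factor, the ray and a charged factor, i.e. would be a `Mixed` `N` of the same charge; so (CASE A, two further
charged factors) RULE D forces all four of their coordinates to be equal — impossible for a charged letter of `𝒰` — or (CASE B, a second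
O-factor) RULE D at the pair (O-coordinate 0, charged coordinate) has no server and no cover. -/
theorem xinfA_P {c : ℕ} (hNc : ∀ Z ∈ C.lower, ∀ f σ s, Z σ s = c → ¬ Mixed Z f σ s)
    {P : Cell} (hPu : P ∈ C.upper) {f σ : Fin 4} {s : Fin 2} (hc : P σ s = c) (hm : Mixed P f σ s) : False := by
  obtain ⟨hO, hray, g, hgf, hgσ, hch⟩ := hm
  have hfσ : f ≠ σ := fun h => hray.1 (by rw [← h]; fin_cases s; exacts [hO.1, hO.2])
  obtain ⟨h, hhf, hhσ, hhg⟩ := exists_fourth f σ g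
  -- a server or cover above `P` touching neither `σ` nor the chosen O-factor is a Mixed N of charge c
  have key : ∀ N ∈ C.lower, ∀ o : Fin 4, o ≠ σ → isO P o → (∀ r, N o r = P o r) → (∀ r, N σ r = P σ r) →
      ∀ k : Fin 4, k ≠ o → k ≠ σ → ¬ isO N k → False := fun N hNl o hoσ hoO hfo hσo k hko hkσ hk =>
    hNc N hNl o σ s (by rw [hσo]; exact hc) (mixed_of_eq hoO hray hko hkσ hfo hσo hk)
  by_cases hhO : isO P h
  · -- CASE B
    obtain ⟨r, hr⟩ : ∃ r, P g r ≠ 0 := by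
      by_contra hno; push Not at hno; exact hch ⟨hno 0, hno 1⟩
    rcases hD.2 P hPu f g hgf.symm 0 r (by rw [hO.1]; exact Ne.symm hr) with ⟨N, hNl, hag, -⟩ | ⟨N, hNl, hag, hlt⟩ |
        ⟨N, hNl, hag, -, hlt⟩
    · exact key N hNl h hhσ hhO (fun q => hag h q (fun e => hhf e.1)) (fun q => hag σ q (fun e => hfσ.symm e.1)) g hhg.symm hgσ
        fun hO' => hch ⟨by rw [← hag g 0 (fun e => hgf e.1)]; exact hO'.1, by rw [← hag g 1 (fun e => hgf e.1)]; exact hO'.2⟩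
    · exact key N hNl f hfσ hO (fun q => hag f q (fun e => hgf.symm e.1)) (fun q => hag σ q (fun e => hgσ.symm e.1)) g hgf hgσ
        fun hO' => absurd (show N g r = 0 by fin_cases r; exacts [hO'.1, hO'.2]) (by omega)
    · exact key N hNl h hhσ hhO (fun q => hag h q (fun e => hhf e.1) (fun e => hhg e.1))
        (fun q => hag σ q (fun e => hfσ.symm e.1) (fun e => hgσ.symm e.1)) g hhg.symm hgσ
        fun hO' => absurd (show N g r = 0 by fin_cases r; exacts [hO'.1, hO'.2]) (by omega)
  · -- CASE A
    have hall : ∀ r q : Fin 2, P g r = P h q := by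
      intro r q
      by_contra hne
      rcases hD.2 P hPu g h hhg.symm r q hne with ⟨N, hNl, hag, hlt⟩ | ⟨N, hNl, hag, hlt⟩ | ⟨N, hNl, hag, hlt, hlt'⟩
      · exact key N hNl f hfσ hO (fun q' => hag f q' (fun e => hgf.symm e.1)) (fun q' => hag σ q' (fun e => hgσ.symm e.1)) g hgf
          hgσ fun hO' => absurd (show N g r = 0 by fin_cases r; exacts [hO'.1, hO'.2]) (by omega)
      · exact key N hNl f hfσ hO (fun q' => hag f q' (fun e => hhf.symm e.1)) (fun q' => hag σ q' (fun e => hhσ.symm e.1)) h hhf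
          hhσ fun hO' => absurd (show N h q = 0 by fin_cases q; exacts [hO'.1, hO'.2]) (by omega)
      · exact key N hNl f hfσ hO (fun q' => hag f q' (fun e => hgf.symm e.1) (fun e => hhf.symm e.1))
          (fun q' => hag σ q' (fun e => hgσ.symm e.1) (fun e => hhσ.symm e.1)) g hgf hgσ
          fun hO' => absurd (show N g r = 0 by fin_cases r; exacts [hO'.1, hO'.2]) (by omega)
    exact coords_ne_of_charged (hU P hPu) hch (by rw [hall 0 0, ← hall 1 0])

include hD hS hX hU in
/-- **LEMMA X∞-A** (bc5-plan g4 memo v4.1 §2, pencil ×1 — LEG A review pending at typing time): in a RULE-D-closed, PSC, X-clean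
configuration no cell of either level carries an O-letter, a pure-ray letter and a further charged letter. Induction on the ray charge
in the order (N_1), (P_1), (N_2), (P_2), … . No alphabet hypothesis beyond `InUscr` on the `P`-cells (used once, in CASE A). -/
theorem xinfA (c : ℕ) :
    (∀ Z ∈ C.lower, ∀ f σ s, Z σ s = c → ¬ Mixed Z f σ s) ∧ (∀ P ∈ C.upper, ∀ f σ s, P σ s = c → ¬ Mixed P f σ s) := by
  induction c using Nat.strong_induction_on with
  | _ c ih =>
    have hN : ∀ Z ∈ C.lower, ∀ f σ s, Z σ s = c → ¬ Mixed Z f σ s := fun Z hZ f σ s hc hm =>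
      xinfA_N hD hS hX (fun c' hc' => (ih c' hc').2) hZ hc hm
    exact ⟨hN, fun P hPu f σ s hc hm => xinfA_P hD hU hN hPu hc hm⟩

include hD hS hX hU in
/-- LEMMA X∞-A, unindexed form. -/
theorem no_mixed : (∀ Z ∈ C.lower, ∀ f σ s, ¬ Mixed Z f σ s) ∧ (∀ P ∈ C.upper, ∀ f σ s, ¬ Mixed P f σ s) :=
  ⟨fun Z hZ f σ s => (xinfA hD hS hX hU (Z σ s)).1 Z hZ f σ s rfl,
    fun P hPu f σ s => (xinfA hD hS hX hU (P σ s)).2 P hPu f σ s rfl⟩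


/-! ## §4 COROLLARY A′ (memo v4.1 §3, first half): no class charged on two factors carries an O-letter -/

include hD hS hX hU in
/-- **COROLLARY A′, `N`-side**: in a RULE-D-closed, PSC, X-clean configuration with cells in `𝒰`, no `N`-cell with an O-factor is
charged on two further factors. (A charged non-ray letter of `𝒰` is a tower `(c+1, 1)`; by RULE D against the O-factor its
coordinate `1` is served below — `Pad4TowerLemmaT.servedBelow_of_zero` — and the leg is the antipodal partner carrying the pure ray
`(c+1)ℓ`, a `Mixed` `P`-cell, excluded by LEMMA X∞-A.) -/
theorem no_O_biCharged_N (hUN : ∀ Z ∈ C.lower, InUscr Z) {Z : Cell} (hZ : Z ∈ C.lower) {f j k : Fin 4} (hO : isO Z f)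
    (hjf : j ≠ f) (hkf : k ≠ f) (hjk : j ≠ k) (hj : ¬ isO Z j) (hk : ¬ isO Z k) : False := by
  have hnm := (no_mixed hD hS hX hU).1 Z hZ
  -- the charged factor j is not a pure ray (that would be Mixed), so it is a tower with a coordinate equal to 1
  have hray : ∀ t : Fin 2, Z j t ≠ 0 → Z j t.rev = 0 → False := fun t h1 h0 => hnm f j t ⟨hO, ⟨h1, h0⟩, k, hkf, Ne.symm hjk, hk⟩
  obtain ⟨t, ht1, ht2⟩ : ∃ t : Fin 2, Z j t = 1 ∧ 2 ≤ Z j t.rev := by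
    rcases hUN Z hZ j with h | h | ⟨hmin, hmax⟩
    · exact (hray 1 (fun h1 => hj ⟨h, h1⟩) h).elim
    · exact (hray 0 (fun h0 => hj ⟨h0, h⟩) h).elim
    · rcases le_total (Z j 0) (Z j 1) with hle | hle
      · exact ⟨0, by rw [min_eq_left hle] at hmin; exact hmin, by rw [max_eq_right hle] at hmax; exact hmax⟩
      · exact ⟨1, by rw [min_eq_right hle] at hmin; exact hmin, by rw [max_eq_left hle] at hmax; exact hmax⟩
  have hf0 : Z f t = 0 := by fin_cases t; exacts [hO.1, hO.2]
  obtain ⟨P, hPu, hag, hlt⟩ := servedBelow_of_zero C (hD.1 Z hZ) hf0 hjf (by rw [ht1]; decide)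
  have hP0 : P j t = 0 := by omega
  refine (no_mixed hD hS hX hU).2 P hPu f j t.rev ⟨⟨?_, ?_⟩, ⟨?_, ?_⟩, k, hkf, Ne.symm hjk, fun hO' => hk ⟨?_, ?_⟩⟩
  · rw [hag f 0 (fun h => hjf.symm h.1)]; exact hO.1
  · rw [hag f 1 (fun h => hjf.symm h.1)]; exact hO.2
  · rw [hag j t.rev (fun h => absurd h.2 (by fin_cases t <;> decide))]; omega
  · rw [Fin.rev_rev]; exact hP0
  · rw [← hag k 0 (fun h => hjk.symm h.1)]; exact hO'.1
  · rw [← hag k 1 (fun h => hjk.symm h.1)]; exact hO'.2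

include hD hS hX hU in
/-- **COROLLARY A′, `P`-side**: likewise no `P`-cell with an O-factor is charged on two further factors. (Its two charged letters are
towers — a ray would be `Mixed`; RULE D at the pair (own coordinate `c+1 ≥ 2` of one tower, antipodal coordinate `1` of the other):
the own coordinate's server is an `N` with an O-factor charged twice — excluded above; raising the antipodal `1` leaves `𝒰`.) -/
theorem no_O_biCharged_P (hUN : ∀ Z ∈ C.lower, InUscr Z) {P : Cell} (hPu : P ∈ C.upper) {f j k : Fin 4} (hO : isO P f)
    (hjf : j ≠ f) (hkf : k ≠ f) (hjk : j ≠ k) (hj : ¬ isO P j) (hk : ¬ isO P k) : False := by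
  have hnm := (no_mixed hD hS hX hU).2 P hPu
  -- both charged factors are towers: own coordinate ≥ 2 on side u, antipodal coordinate 1
  have tower : ∀ g k' : Fin 4, g ≠ f → k' ≠ f → g ≠ k' → ¬ isO P g → ¬ isO P k' →
      ∃ u : Fin 2, 2 ≤ P g u ∧ P g u.rev = 1 := by
    intro g k' hgf hk'f hgk' hg hk'
    have hray : ∀ t : Fin 2, P g t ≠ 0 → P g t.rev = 0 → False :=
      fun t h1 h0 => hnm f g t ⟨hO, ⟨h1, h0⟩, k', hk'f, Ne.symm hgk', hk'⟩
    rcases hU P hPu g with h | h | ⟨hmin, hmax⟩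
    · exact (hray 1 (fun h1 => hg ⟨h, h1⟩) h).elim
    · exact (hray 0 (fun h0 => hg ⟨h0, h⟩) h).elim
    · rcases le_total (P g 0) (P g 1) with hle | hle
      · exact ⟨1, by rw [max_eq_right hle] at hmax; exact hmax, by rw [min_eq_left hle] at hmin; exact hmin⟩
      · exact ⟨0, by rw [max_eq_left hle] at hmax; exact hmax, by rw [min_eq_right hle] at hmin; exact hmin⟩
  obtain ⟨u, hju, hju'⟩ := tower j k hjf hkf hjk hj hk
  obtain ⟨v, hkv, hkv'⟩ := tower k j hkf hjf hjk.symm hk hj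
  -- an N-cell raised at the antipodal coordinate of the tower k is not in 𝒰
  have notU : ∀ N ∈ C.lower, (N k v = P k v) → P k v.rev < N k v.rev → False := fun N hNl hv hlt => by
    have hv2 : 2 ≤ N k v := by rw [hv]; exact hkv
    have hv2' : 2 ≤ N k v.rev := by omega
    have h0 : 2 ≤ N k 0 := by
      rcases (show (0 : Fin 2) = v ∨ (0 : Fin 2) = v.rev by fin_cases v <;> decide) with h | h <;> rw [h] <;> assumption
    have h1 : 2 ≤ N k 1 := by
      rcases (show (1 : Fin 2) = v ∨ (1 : Fin 2) = v.rev by fin_cases v <;> decide) with h | h <;> rw [h] <;> assumption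
    rcases hUN N hNl k with h | h | ⟨hmin, -⟩
    · omega
    · omega
    · have := le_min h0 h1; omega
  rcases hD.2 P hPu j k hjk u v.rev (by omega) with ⟨N, hNl, hag, hlt⟩ | ⟨N, hNl, hag, hlt⟩ | ⟨N, hNl, hag, -, hlt⟩
  · -- own-up server of the tower j: an N with O at f, charged on j and k
    refine no_O_biCharged_N hD hS hX hU hUN hNl (f := f) (j := j) (k := k) ⟨?_, ?_⟩ hjf hkf hjk ?_ ?_
    · rw [hag f 0 (fun h => hjf.symm h.1)]; exact hO.1
    · rw [hag f 1 (fun h => hjf.symm h.1)]; exact hO.2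
    · intro hO'; have : N j u = 0 := by fin_cases u; exacts [hO'.1, hO'.2]
      omega
    · intro hO'; apply hk; exact ⟨by rw [← hag k 0 (fun h => hjk.symm h.1)]; exact hO'.1,
        by rw [← hag k 1 (fun h => hjk.symm h.1)]; exact hO'.2⟩
  · exact notU N hNl (hag k v (fun h => absurd h.2 (by fin_cases v <;> decide))) hlt
  · exact notU N hNl (hag k v (fun h => hjk.symm h.1) (fun h => absurd h.2 (by fin_cases v <;> decide))) hlt

end

end Summit.Ventures.HSemireg.Pad4Tower
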